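import Literature.Probability.LatticeModels.PlaneRotatorOnsagerWindow
import Literature.Probability.LatticeModels.IsingSusceptibilityFromDCTBox
import Literature.Probability.LatticeModels.RegularScales
import HarnessLib

/-!
# The susceptibility of the planar Ising model above `T_c` from the exact row correlations
# (Toeplitz determinants of Onsager's symbol): `χ(β) ≤ (1 + ∑_{k ≤ L} 8k·D_k(φ_β)) / (1 − 32L·tanh β·D_L(φ_β))`

Topic `Literature/Probability/LatticeModels`, namespace `Literature.Probability.LatticeModels`. The tree holds the
exact solution of the two-dimensional nearest-neighbour Ising model above `T_c` in the form
`(σ_{(0,0)}σ_{(k,0)})_p(β) = D_k(φ_β)` — the periodic row correlation IS the `k × k` Toeplitz determinant of Onsager's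
symbol (`torusRowPairLimit_eq_toeplitzDet` on the proved fact `torusRowPair_tendsto_toeplitzDet_holds`; E. W. Montroll,
R. B. Potts, J. C. Ward, J. Math. Phys. **4** (1963) 308 [MontrollPottsWard1963]; P. Deift, A. Its, I. Krasovsky,
Comm. Pure Appl. Math. **66** (2013) 1360, §4 eq. (50) [DeiftItsKrasovsky2013]) — together with the GKS sandwich
`⟨σ₀σ_{(k,0)}⟩^∅_β ≤ (σσ)_p(β)(k)` (Benettin–Gallavotti–Jona-Lasinio–Stella 1973, eq. (3.7),
`torusRowPairLimit_sandwich_of_exists`), the Messager–Miracle-Solé axis monotonicity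
`⟨σ₀σ_y⟩^∅ ≤ ⟨σ₀σ_{‖y‖_∞ e₁}⟩^∅` ([MessagerMiracleSoleJSP1977], `twoPointFree_le_single_of_le`) and the Duminil-Copin–Tassion
box iteration (`tailSum_le_pow_mul_tsum`, [DuminilCopinTassionCMP2016] §2.5; Panis 2023 Rem. 3.22, the summed form
`χ ≤ |Λ_K|/(1 − φ_β(S))`, tree `tsum_twoPointFree_le_card_div`). This file replaces the crude `|Λ_L| = (2L+1)²` of that
summed form by the exact row data:

* §1 `torusRowPairLimit_eq_re_toeplitzDet` — `(σσ)_p(β)(k) = Re D_k(φ_β)` (`0 < β ≠ β_c(2)`);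
  `twoPointFree_two_le_torusRowPairLimit` — `⟨σ₀σ_x⟩^∅_β ≤ (σσ)_p(β)(‖x‖_∞)` (MMS + GKS sandwich), hence
  `torusRowPairLimit_nonneg`.
* §2 **`sum_box_twoPointFree_two_le`** (with the private count `#{‖y‖_∞ = k} = 8k`, `k ≥ 1`):
  `∑_{x ∈ Λ_L} ⟨σ₀σ_x⟩^∅_β ≤ 1 + ∑_{k=1}^{L} 8k·(σσ)_p(β)(k)`.
* §3 **`dctIsingPhi_box_two_le`**: the Duminil-Copin–Tassion number of the box `Λ_L` is small when the row correlation at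
  distance `L` is: `φ_β(Λ_L) ≤ 32L·tanh β·(σσ)_p(β)(L)` (only boundary sites have outside neighbours, each at most `4`,
  and `⟨σ₀σ_x⟩_{Λ_L} ≤ ⟨σ₀σ_x⟩^∅ ≤ (σσ)_p(‖x‖_∞ = L)`).
* §4 **`tsum_twoPointFree_two_le_of_rowBounds`** — for `0 < β`, `L ≥ 1` and numbers `A ≥ ∑_{k<L} 8(k+1)(σσ)_p(β)(k+1)`,
  `dL ≥ (σσ)_p(β)(L)` with `32L·tanh β·dL < 1`: `x ↦ ⟨σ₀σ_x⟩^∅_β` is summable and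
  `χ(β) = ∑_x ⟨σ₀σ_x⟩^∅_β ≤ (1 + A)/(1 − 32L·tanh β·dL)`; the `β`-monotone form `…_of_le` (certificate at `β₀ ≥ β`,
  GKS II) and the finite-volume form `sum_isingTwoPoint_free_le_of_rowBounds` (`∑_{v ∈ Λ} ⟨σ_uσ_v⟩^∅_{Λ;β} ≤ …`).
* §5 the same with the hypotheses written on the Toeplitz determinants themselves
  (`tsum_twoPointFree_two_le_of_toeplitz`, `sum_isingTwoPoint_free_le_of_toeplitz`): the two numbers
  `∑_{k<L} 8(k+1)·Re D_{k+1}(φ_{β₀})` and `Re D_L(φ_{β₀})` are CERTIFIABLE — `D_k` is a `k × k` determinant of Fourier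
  coefficients of an explicit algebraic function (interval arithmetic; cell `pub/hubbard-tc` kit j287898, Arb balls:
  at `β₀ = 0.43`, `L = 240`: `A ≤ 823.556`, `D_L ≤ 2.3823·10⁻⁶`, hence `χ(0.43) ≤ 830.8`; the summed DCT form with
  the tree's largest exact box `Λ₁₀` gives `X ≈ 1.5·10³` already at `β₀ = 0.40`).

Cell use (`pub/hubbard-tc`, MO-S3, seat mod-1, ASSUMPTIONS §1 key K4-c): the certified single-layer susceptibility
ceiling that the layer-decoupling theorem `PlaneRotator.twoPoint_layered_le_pow_interlayer'` consumes, near the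
Aizenman–Simon–Onsager window edge (`LayeredPlaneRotatorToeplitzCertificate.lean`). Classical planar Ising model only.

Not here: the numerics of `D_k`; any statement at `β ≥ β_c(2)`.
-/

noncomputable section

namespace Literature.Probability.LatticeModels

open Finset Filter Topology Literature.Analysis.Toeplitz

/-! ## §1 The exact row correlation dominates the free two-point function -/

/-- **The periodic row limit is the Toeplitz determinant** (real part form): for `0 < β ≠ β_c(2)`,
`(σ_{(0,0)}σ_{(k,0)})_p(β) = Re D_k(φ_β)` — the tree's `torusRowPairLimit_eq_toeplitzDet` on the proved
Montroll–Potts–Ward fact `torusRowPair_tendsto_toeplitzDet_holds`. [cite: DeiftItsKrasovsky2013, §4, eq. (50)]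
[cite: MontrollPottsWard1963, main formula: row correlation = Toeplitz determinant of Onsager's function (= DeiftItsKrasovsky2013 §4 eq. (50))] -/
theorem torusRowPairLimit_eq_re_toeplitzDet {β : ℝ} (hβ : 0 < β) (hβc : β ≠ criticalBetaTwo) (k : ℕ) :
    torusRowPairLimit β k = (toeplitzDet (circleCoeff (onsagerSymbol β)) k).re := by
  rw [← torusRowPairLimit_eq_toeplitzDet torusRowPair_tendsto_toeplitzDet_holds hβ hβc k, Complex.ofReal_re]

/-- **`⟨σ₀σ_x⟩^∅_β ≤ (σσ)_p(β)(‖x‖_∞)`** for `β ≥ 0`: Messager–Miracle-Solé (`⟨σ₀σ_x⟩^∅ ≤ ⟨σ₀σ_{‖x‖_∞ e₁}⟩^∅`,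
tree `twoPointFree_le_single_of_le`) and the GKS sandwich free ≤ periodic limit (BGJS (3.7),
`torusRowPairLimit_sandwich_of_exists` on the proved existence fact `tendsto_torusRowPair_exists_holds`).
[cite: MessagerMiracleSoleJSP1977, main theorem (monotonicity of ⟨σ₀σ_x⟩ under reflections)]
[cite: BenettinGallavottiJonaLasinioStella1973, eq. (3.7)] -/
theorem twoPointFree_two_le_torusRowPairLimit {β : ℝ} (hβ : 0 ≤ β) (x : Site 2) :
    twoPointFree 2 β x ≤ torusRowPairLimit β (Site.supNorm x) := by
  have h1 := twoPointFree_le_single_of_le hβ (by norm_num : 1 ≤ 2) (y := x) (s := Site.supNorm x) le_rfl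
  have h2 : (Pi.single (⟨0, by norm_num⟩ : Fin 2) ((Site.supNorm x : ℕ) : ℤ) : Site 2) =
      ![((Site.supNorm x : ℕ) : ℤ), 0] := single_zero_eq_vec _
  rw [h2] at h1
  exact h1.trans (torusRowPairLimit_sandwich_of_exists tendsto_torusRowPair_exists_holds hβ (Site.supNorm x)).1

/-- `(σσ)_p(β)(k) ≥ 0` for `β ≥ 0` (it dominates `⟨σ₀σ_{(k,0)}⟩^∅_β ≥ 0`, GKS I).
[cite: BenettinGallavottiJonaLasinioStella1973, eq. (3.7)] -/
theorem torusRowPairLimit_nonneg {β : ℝ} (hβ : 0 ≤ β) (k : ℕ) : 0 ≤ torusRowPairLimit β k :=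
  (twoPointFree_nonneg_of_nonneg hβ _).trans
    (torusRowPairLimit_sandwich_of_exists tendsto_torusRowPair_exists_holds hβ k).1

/-! ## §2 The box sum through the spheres `‖x‖_∞ = k` -/

/-- In two dimensions the sphere `{‖y‖_∞ = k}` (`k ≥ 1`) has exactly `(2k+1)² − (2k−1)² = 8k` points. [folklore] -/
private theorem card_sphere_two {k : ℕ} (hk : 1 ≤ k) : #(sphere 2 k) = 8 * k := by
  have hsub : box 2 (k - 1) ⊆ box 2 k := box_mono 2 (Nat.sub_le k 1)
  have heq : sphere 2 k = box 2 k \ box 2 (k - 1) := by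
    ext y
    simp only [mem_sphere, Finset.mem_sdiff, mem_box_iff_supNorm_le]
    omega
  rw [heq, Finset.card_sdiff_of_subset hsub, card_box, card_box]
  obtain ⟨j, rfl⟩ : ∃ j, k = j + 1 := ⟨k - 1, by omega⟩
  simp only [Nat.add_sub_cancel]
  ring_nf
  omega

/-- The fibre of the box `Λ_L` over `‖·‖_∞ = k` lies in the sphere of radius `k`. [folklore] -/
private theorem filter_box_supNorm_subset_sphere (L k : ℕ) :
    (box 2 L).filter (fun x => Site.supNorm x = k) ⊆ sphere 2 k := by
  intro x hx
  exact mem_sphere.2 (Finset.mem_filter.1 hx).2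

/-- **Box sum of the free two-point function from the row correlations**: for `β ≥ 0` and every `L`,
`∑_{x ∈ Λ_L} ⟨σ₀σ_x⟩^∅_β ≤ 1 + ∑_{k<L} 8(k+1)·(σσ)_p(β)(k+1)` (the origin, then `8k` sites on the sphere of radius
`k`, each bounded by the row value by Messager–Miracle-Solé). [cite: MessagerMiracleSoleJSP1977, main theorem (monotonicity of ⟨σ₀σ_x⟩ under reflections)]
[cite: BenettinGallavottiJonaLasinioStella1973, eq. (3.7)] -/
theorem sum_box_twoPointFree_two_le {β : ℝ} (hβ : 0 ≤ β) (L : ℕ) :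
    ∑ x ∈ box 2 L, twoPointFree 2 β x ≤
      1 + ∑ k ∈ Finset.range L, 8 * ((k : ℝ) + 1) * torusRowPairLimit β (k + 1) := by
  classical
  -- split the box sum over the fibres of `‖·‖_∞`
  have hmaps : ∀ x ∈ box 2 L, Site.supNorm x ∈ Finset.range (L + 1) := fun x hx =>
    Finset.mem_range.2 (Nat.lt_succ_of_le (mem_box_iff_supNorm_le.1 hx))
  rw [← Finset.sum_fiberwise_of_maps_to hmaps]
  -- each fibre: `k = 0` is the origin, `k ≥ 1` is at most `8k·(σσ)_p(k)`
  have hfib : ∀ k ∈ Finset.range (L + 1),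
      ∑ x ∈ (box 2 L).filter (fun x => Site.supNorm x = k), twoPointFree 2 β x ≤
        if k = 0 then 1 else 8 * (k : ℝ) * torusRowPairLimit β k := by
    intro k _
    split_ifs with hk
    · subst hk
      have hset : (box 2 L).filter (fun x => Site.supNorm x = 0) = {0} := by
        ext x
        simp only [Finset.mem_filter, mem_box_iff_supNorm_le, Site.supNorm_eq_zero_iff, Finset.mem_singleton]
        constructor
        · rintro ⟨-, h⟩; exact h
        · rintro rfl; exact ⟨by simp [Site.supNorm_eq_zero_iff.2 rfl], rfl⟩
      rw [hset, Finset.sum_singleton, twoPointFree_zero]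
    · have hk1 : 1 ≤ k := Nat.one_le_iff_ne_zero.2 hk
      calc ∑ x ∈ (box 2 L).filter (fun x => Site.supNorm x = k), twoPointFree 2 β x
          ≤ ∑ x ∈ (box 2 L).filter (fun x => Site.supNorm x = k), torusRowPairLimit β k := by
            refine Finset.sum_le_sum fun x hx => ?_
            have hxk : Site.supNorm x = k := (Finset.mem_filter.1 hx).2
            simpa [hxk] using twoPointFree_two_le_torusRowPairLimit hβ x
        _ = #((box 2 L).filter (fun x => Site.supNorm x = k)) * torusRowPairLimit β k := by
            rw [Finset.sum_const, nsmul_eq_mul]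
        _ ≤ (8 * k : ℕ) * torusRowPairLimit β k := by
            refine mul_le_mul_of_nonneg_right ?_ (torusRowPairLimit_nonneg hβ k)
            exact_mod_cast (Finset.card_le_card (filter_box_supNorm_subset_sphere L k)).trans
              (card_sphere_two hk1).le
        _ = 8 * (k : ℝ) * torusRowPairLimit β k := by push_cast; ring
  refine (Finset.sum_le_sum hfib).trans (le_of_eq ?_)
  rw [Finset.sum_range_succ', if_pos rfl, add_comm]
  congr 1
  refine Finset.sum_congr rfl fun k _ => ?_
  rw [if_neg (Nat.succ_ne_zero k)]
  push_cast
  ring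

/-! ## §3 The Duminil-Copin–Tassion number of a box from the row correlation at its edge -/

/-- **`φ_β(Λ_L) ≤ 32L·tanh β·(σσ)_p(β)(L)`** (`β ≥ 0`, `L ≥ 1`): in `φ_β(Λ_L) = ∑_{x ∈ Λ_L} ∑_{y ∉ Λ_L, y ∼ x}
tanh β ⟨σ₀σ_x⟩_{Λ_L}` only sites with `‖x‖_∞ = L` contribute (`8L` of them, at most `4` outside neighbours each), and
`⟨σ₀σ_x⟩_{Λ_L} ≤ ⟨σ₀σ_x⟩^∅ ≤ (σσ)_p(β)(L)` by GKS volume monotonicity and Messager–Miracle-Solé.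
[cite: DuminilCopinTassionCMP2016, §2.5 (arXiv:1502.03050 numbering)] [cite: MessagerMiracleSoleJSP1977, main theorem (monotonicity of ⟨σ₀σ_x⟩ under reflections)] -/
theorem dctIsingPhi_box_two_le {β : ℝ} (hβ : 0 ≤ β) {L : ℕ} (hL : 1 ≤ L) :
    dctIsingPhi 2 β (box 2 L) ≤ 32 * L * Real.tanh β * torusRowPairLimit β L := by
  classical
  have hgks : ∀ {Λ A : Finset (Site 2)} {β h : ℝ} {bc : BoundaryCondition (Site 2)},
      gks_one (zdGraph 2) (Λ := Λ) (A := A) (β := β) (h := h) (bc := bc) :=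
    GKSInequalities.gks_one_holds (zdGraph 2)
  have hgks2 : ∀ (G' : SimpleGraph (Site 2)) [G'.LocallyFinite] (Λ A B : Finset (Site 2))
      (β h : ℝ) (bc : BoundaryCondition (Site 2)),
      gks_two G' (Λ := Λ) (A := A) (B := B) (β := β) (h := h) (bc := bc) :=
    fun G' _ _ _ _ _ _ _ => GKSInequalities.gks_two_holds G'
  have hlim : hasBoxLimit_isingCorr_free 2 := hasBoxLimit_isingCorr_free_holds
  have hmono : isingCorr_free_mono_volume (d := 2) := isingCorr_free_mono_volume_of_gks_two hgks2
  have htr : isingTwoPoint_free_translate (d := 2) := isingTwoPoint_free_translate_holds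
  have hD0 : 0 ≤ torusRowPairLimit β L := torusRowPairLimit_nonneg hβ L
  have hth : 0 ≤ Real.tanh β := tanh_nonneg hβ
  set N : Site 2 → Finset (Site 2) := fun x => ((zdGraph 2).neighborFinset x).filter (fun y => y ∉ box 2 L)
    with hN
  rw [dctIsingPhi_def]
  -- each site contributes at most `4 tanh β (σσ)_p(L)`, and only if `‖x‖_∞ = L`
  have hterm : ∀ x ∈ box 2 L,
      ∑ _y ∈ N x, Real.tanh β * isingTwoPoint (zdGraph 2) (box 2 L) β 0 .free 0 x ≤
        if Site.supNorm x = L then 4 * (Real.tanh β * torusRowPairLimit β L) else 0 := by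
    intro x hx
    rw [Finset.sum_const, nsmul_eq_mul]
    split_ifs with hxL
    · have hcard : (#(N x) : ℝ) ≤ 4 := by
        have h1 : #(N x) ≤ #((zdGraph 2).neighborFinset x) := Finset.card_le_card (Finset.filter_subset _ _)
        have h2 : #((zdGraph 2).neighborFinset x) = 2 * 2 := card_neighborFinset_zdGraph_holds (d := 2) x
        exact_mod_cast h1.trans (by omega)
      have hI : isingTwoPoint (zdGraph 2) (box 2 L) β 0 .free 0 x ≤ torusRowPairLimit β L := by
        have h1 := isingTwoPoint_free_le_twoPointFree_sub hmono hlim htr hβ (zero_mem_box 2 L) hx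
        rw [sub_zero] at h1
        have h2 := twoPointFree_two_le_torusRowPairLimit hβ x
        rw [hxL] at h2
        exact h1.trans h2
      have hI0 : 0 ≤ isingTwoPoint (zdGraph 2) (box 2 L) β 0 .free 0 x :=
        isingTwoPoint_free_nonneg hgks hβ (zero_mem_box 2 L) hx
      calc (#(N x) : ℝ) * (Real.tanh β * isingTwoPoint (zdGraph 2) (box 2 L) β 0 .free 0 x)
          ≤ 4 * (Real.tanh β * isingTwoPoint (zdGraph 2) (box 2 L) β 0 .free 0 x) :=
            mul_le_mul_of_nonneg_right hcard (mul_nonneg hth hI0)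
        _ ≤ 4 * (Real.tanh β * torusRowPairLimit β L) := by gcongr
    · -- no outside neighbour: `N x = ∅`
      have hempty : N x = ∅ := by
        refine Finset.eq_empty_of_forall_notMem fun y hy => ?_
        obtain ⟨hy1, hy2⟩ := Finset.mem_filter.1 hy
        have hadj : (zdGraph 2).Adj x y := (SimpleGraph.mem_neighborFinset _ _ _).1 hy1
        have h1 : Site.supNorm y ≤ Site.supNorm x + 1 := Site.supNorm_le_succ_of_adj hadj
        have hxle : Site.supNorm x ≤ L := mem_box_iff_supNorm_le.1 hx
        have hylt : L < Site.supNorm y := by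
          by_contra h
          exact hy2 (mem_box_iff_supNorm_le.2 (not_lt.1 h))
        omega
      rw [hempty, Finset.card_empty, Nat.cast_zero, zero_mul]
  refine (Finset.sum_le_sum hterm).trans ?_
  rw [← Finset.sum_filter, Finset.sum_const, nsmul_eq_mul]
  have hcard : (#((box 2 L).filter (fun x => Site.supNorm x = L)) : ℝ) ≤ 8 * L := by
    have h := (Finset.card_le_card (filter_box_supNorm_subset_sphere L L)).trans (card_sphere_two hL).le
    exact_mod_cast h
  calc (#((box 2 L).filter (fun x => Site.supNorm x = L)) : ℝ) * (4 * (Real.tanh β * torusRowPairLimit β L))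
      ≤ 8 * L * (4 * (Real.tanh β * torusRowPairLimit β L)) :=
        mul_le_mul_of_nonneg_right hcard (by positivity)
    _ = 32 * L * Real.tanh β * torusRowPairLimit β L := by ring

/-! ## §4 The susceptibility from the row bounds -/

/-- **Susceptibility of the planar Ising model from the row correlations** (the Duminil-Copin–Tassion box iteration
on `Λ_L`, with the box sum and the box number bounded through the exact row values): for `β > 0`, `L ≥ 1` and numbers
`A ≥ ∑_{k<L} 8(k+1)·(σσ)_p(β)(k+1)`, `dL ≥ (σσ)_p(β)(L)` with `32L·tanh β·dL < 1`, the free two-point function is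
summable and

  `χ(β) = ∑_{x ∈ ℤ²} ⟨σ₀σ_x⟩^∅_β ≤ (1 + A) / (1 − 32L·tanh β·dL)`.

[cite: DuminilCopinTassionCMP2016, §2.5 (arXiv:1502.03050 numbering)] [cite: Panis2023Triviality, Rem. 3.22] -/
theorem tsum_twoPointFree_two_le_of_rowBounds {β : ℝ} (hβ : 0 < β) {L : ℕ} (hL : 1 ≤ L) {A dL : ℝ}
    (hA : ∑ k ∈ Finset.range L, 8 * ((k : ℝ) + 1) * torusRowPairLimit β (k + 1) ≤ A)
    (hdL : torusRowPairLimit β L ≤ dL) (hφ : 32 * L * Real.tanh β * dL < 1) :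
    Summable (twoPointFree 2 β) ∧
      (∑' v, twoPointFree 2 β v) ≤ (1 + A) / (1 - 32 * L * Real.tanh β * dL) := by
  classical
  have hgks : ∀ {Λ A : Finset (Site 2)} {β h : ℝ} {bc : BoundaryCondition (Site 2)},
      gks_one (zdGraph 2) (Λ := Λ) (A := A) (β := β) (h := h) (bc := bc) :=
    GKSInequalities.gks_one_holds (zdGraph 2)
  have hgks2 : ∀ (G' : SimpleGraph (Site 2)) [G'.LocallyFinite] (Λ A B : Finset (Site 2))
      (β h : ℝ) (bc : BoundaryCondition (Site 2)),
      gks_two G' (Λ := Λ) (A := A) (B := B) (β := β) (h := h) (bc := bc) :=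
    fun G' _ _ _ _ _ _ _ => GKSInequalities.gks_two_holds G'
  have hlim : hasBoxLimit_isingCorr_free 2 := hasBoxLimit_isingCorr_free_holds
  have hmono : isingCorr_free_mono_volume (d := 2) := isingCorr_free_mono_volume_of_gks_two hgks2
  have hMS : dct_modifiedSimon_finiteVolume (d := 2) := dct_modifiedSimon_finiteVolume_holds
  have htr : isingTwoPoint_free_translate (d := 2) := isingTwoPoint_free_translate_holds
  have hth : 0 ≤ Real.tanh β := tanh_nonneg hβ.le
  -- the box number is below `φ̄ = 32 L tanh β dL < 1`
  set φb : ℝ := 32 * L * Real.tanh β * dL with hφb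
  have hφle : dctIsingPhi 2 β (box 2 L) ≤ φb :=
    (dctIsingPhi_box_two_le hβ.le hL).trans (mul_le_mul_of_nonneg_left hdL (by positivity))
  have hφ1 : dctIsingPhi 2 β (box 2 L) < 1 := hφle.trans_lt hφ
  set S : Site 2 → ℝ := twoPointFree 2 β with hSdef
  have hS0 : ∀ v, 0 ≤ S v := fun v => twoPointFree_nonneg hlim hgks hβ.le v
  -- summability from exponential decay
  obtain ⟨c, hc, hdecay⟩ := twoPointFree_exp_decay_of_dctIsingPhi_lt_one hMS htr hgks hlim hmono
    hβ (zero_mem_box 2 L) hφ1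
  have hsum : Summable S :=
    summable_of_exp_decay hS0 hc (C := 1) fun x => by rw [one_mul]; exact hdecay x
  -- the summed Simon–Lieb step on `Λ_L`
  set N : Site 2 → Finset (Site 2) := fun x => ((zdGraph 2).neighborFinset x).filter (fun y => y ∉ box 2 L)
  set cf : Site 2 → ℝ := fun x => Real.tanh β * isingTwoPoint (zdGraph 2) (box 2 L) β 0 .free 0 x
  have hcf : ∀ x ∈ box 2 L, 0 ≤ cf x := fun x hx =>
    mul_nonneg hth (isingTwoPoint_free_nonneg hgks hβ.le (zero_mem_box 2 L) hx)
  have hNK : ∀ x ∈ box 2 L, ∀ y ∈ N x, Site.supNorm y ≤ L + 1 := by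
    intro x hx y hy
    have hadj : (zdGraph 2).Adj x y :=
      (SimpleGraph.mem_neighborFinset _ _ _).1 (Finset.mem_filter.1 hy).1
    have hxK := mem_box_iff_supNorm_le.1 hx
    exact (Site.supNorm_le_succ_of_adj hadj).trans (by omega)
  have hSL : ∀ z, z ∉ box 2 L → S z ≤ ∑ x ∈ box 2 L, ∑ y ∈ N x, cf x * S (z - y) := fun z hz =>
    twoPointFree_le_dct_sum hMS hgks hmono hlim htr hβ (zero_mem_box 2 L) hz
  have hφeq : (∑ x ∈ box 2 L, ∑ _y ∈ N x, cf x) = dctIsingPhi 2 β (box 2 L) := by rw [dctIsingPhi_def]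
  have hiter := tailSum_le_pow_mul_tsum hS0 hsum (subset_refl (box 2 L)) hcf hNK hSL 1
  rw [hφeq, pow_one, one_mul] at hiter
  -- `χ = ∑_{Λ_L} S + U(L+1) ≤ (1 + A) + φ̄ χ`
  set χ : ℝ := ∑' v, S v with hχ
  have hχ0 : 0 ≤ χ := tsum_nonneg hS0
  have hsplit := sum_box_add_tailSum hsum L
  have hbox : ∑ x ∈ box 2 L, S x ≤ 1 + A := (sum_box_twoPointFree_two_le hβ.le L).trans (by linarith)
  have htail : tailSum S (L + 1) ≤ φb * χ :=
    hiter.trans (mul_le_mul_of_nonneg_right hφle hχ0)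
  have hkey : χ * (1 - φb) ≤ 1 + A := by
    have : χ ≤ (1 + A) + φb * χ := by rw [← hχ] at hsplit; linarith
    nlinarith
  exact ⟨hsum, (le_div_iff₀ (sub_pos.2 hφ)).2 hkey⟩

/-- **Row bounds at a larger coupling** (Griffiths' monotonicity in `β`, GKS II): with the row data certified at
`β₀ ≥ β > 0`, the free two-point function at `β` is summable and `χ(β) ≤ (1 + A)/(1 − 32L·tanh β₀·dL)`.
[cite: FriedliVelenik2017, Exercise 3.9 with Thm. 3.20 (free boundary condition)] [cite: Panis2023Triviality, Rem. 3.22] -/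
theorem tsum_twoPointFree_two_le_of_rowBounds_of_le {β₀ β : ℝ} (hβ : 0 < β) (hββ₀ : β ≤ β₀) {L : ℕ}
    (hL : 1 ≤ L) {A dL : ℝ}
    (hA : ∑ k ∈ Finset.range L, 8 * ((k : ℝ) + 1) * torusRowPairLimit β₀ (k + 1) ≤ A)
    (hdL : torusRowPairLimit β₀ L ≤ dL) (hφ : 32 * L * Real.tanh β₀ * dL < 1) :
    Summable (twoPointFree 2 β) ∧
      (∑' v, twoPointFree 2 β v) ≤ (1 + A) / (1 - 32 * L * Real.tanh β₀ * dL) := by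
  have hgks : ∀ {Λ A : Finset (Site 2)} {β h : ℝ} {bc : BoundaryCondition (Site 2)},
      gks_one (zdGraph 2) (Λ := Λ) (A := A) (β := β) (h := h) (bc := bc) :=
    GKSInequalities.gks_one_holds (zdGraph 2)
  have hgks2' : ∀ (Λ A B : Finset (Site 2)) (β h : ℝ) (bc : BoundaryCondition (Site 2)),
      gks_two (zdGraph 2) (Λ := Λ) (A := A) (B := B) (β := β) (h := h) (bc := bc) :=
    fun _ _ _ _ _ _ => GKSInequalities.gks_two_holds (zdGraph 2)
  have hlim : hasBoxLimit_isingCorr_free 2 := hasBoxLimit_isingCorr_free_holds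
  have hβmono : isingCorr_free_mono_beta (d := 2) := isingCorr_free_mono_beta_of_gks_two hgks2'
  obtain ⟨hsum₀, hle₀⟩ := tsum_twoPointFree_two_le_of_rowBounds (hβ.trans_le hββ₀) hL hA hdL hφ
  have hpt : ∀ x, twoPointFree 2 β x ≤ twoPointFree 2 β₀ x := fun x =>
    twoPointFree_mono_beta hβmono hlim hβ.le hββ₀ x
  have h0le : ∀ x, 0 ≤ twoPointFree 2 β x := fun x => twoPointFree_nonneg hlim hgks hβ.le x
  have hsum : Summable (twoPointFree 2 β) := Summable.of_nonneg_of_le h0le hpt hsum₀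
  exact ⟨hsum, (hsum.tsum_le_tsum hpt hsum₀).trans hle₀⟩

/-- **Finite-volume susceptibility from the row bounds**: for every finite `Λ ⊂ ℤ²`, `u ∈ Λ`, `0 < β ≤ β₀` and row
data at `β₀` as above, `∑_{v ∈ Λ} ⟨σ_uσ_v⟩^∅_{Λ;β,0} ≤ (1 + A)/(1 − 32L·tanh β₀·dL)` (volume monotonicity and
translation covariance of the free state, then `tsum_twoPointFree_two_le_of_rowBounds_of_le`).
[cite: FriedliVelenik2017, proof of Thm. 3.17 (p. 114) and Exercise 3.12] [cite: Panis2023Triviality, Rem. 3.22] -/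
theorem sum_isingTwoPoint_free_le_of_rowBounds {β₀ β : ℝ} (hβ : 0 < β) (hββ₀ : β ≤ β₀) {L : ℕ} (hL : 1 ≤ L)
    {A dL : ℝ} (hA : ∑ k ∈ Finset.range L, 8 * ((k : ℝ) + 1) * torusRowPairLimit β₀ (k + 1) ≤ A)
    (hdL : torusRowPairLimit β₀ L ≤ dL) (hφ : 32 * L * Real.tanh β₀ * dL < 1)
    (Λ : Finset (Site 2)) {u : Site 2} (hu : u ∈ Λ) :
    ∑ v ∈ Λ, isingTwoPoint (zdGraph 2) Λ β 0 .free u v ≤ (1 + A) / (1 - 32 * L * Real.tanh β₀ * dL) := by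
  have hgks : ∀ {Λ A : Finset (Site 2)} {β h : ℝ} {bc : BoundaryCondition (Site 2)},
      gks_one (zdGraph 2) (Λ := Λ) (A := A) (β := β) (h := h) (bc := bc) :=
    GKSInequalities.gks_one_holds (zdGraph 2)
  have hgks2 : ∀ (G' : SimpleGraph (Site 2)) [G'.LocallyFinite] (Λ A B : Finset (Site 2))
      (β h : ℝ) (bc : BoundaryCondition (Site 2)),
      gks_two G' (Λ := Λ) (A := A) (B := B) (β := β) (h := h) (bc := bc) :=
    fun G' _ _ _ _ _ _ _ => GKSInequalities.gks_two_holds G'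
  have hlim : hasBoxLimit_isingCorr_free 2 := hasBoxLimit_isingCorr_free_holds
  have hmono : isingCorr_free_mono_volume (d := 2) := isingCorr_free_mono_volume_of_gks_two hgks2
  have htr : isingTwoPoint_free_translate (d := 2) := isingTwoPoint_free_translate_holds
  obtain ⟨hsum, hle⟩ := tsum_twoPointFree_two_le_of_rowBounds_of_le hβ hββ₀ hL hA hdL hφ
  have h0le : ∀ x, 0 ≤ twoPointFree 2 β x := fun x => twoPointFree_nonneg hlim hgks hβ.le x
  calc ∑ v ∈ Λ, isingTwoPoint (zdGraph 2) Λ β 0 .free u v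
      ≤ ∑ v ∈ Λ, twoPointFree 2 β (v - u) :=
        Finset.sum_le_sum fun v hv => isingTwoPoint_free_le_twoPointFree_sub hmono hlim htr hβ.le hu hv
    _ = ∑ w ∈ Λ.image (· - u), twoPointFree 2 β w := by
        rw [Finset.sum_image fun x _ y _ h => sub_left_injective h]
    _ ≤ ∑' w, twoPointFree 2 β w := hsum.sum_le_tsum _ fun w _ => h0le w
    _ ≤ _ := hle

/-! ## §5 The hypotheses on the Toeplitz determinants `D_k(φ_{β₀})` -/

/-- **The susceptibility from certified Toeplitz determinants**: for `0 < β ≤ β₀ < β_c(2)`, `L ≥ 1` and numbers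
`A ≥ ∑_{k<L} 8(k+1)·Re D_{k+1}(φ_{β₀})`, `dL ≥ Re D_L(φ_{β₀})` with `32L·tanh β₀·dL < 1`:
`χ(β) ≤ (1 + A)/(1 − 32L·tanh β₀·dL)`. The two inputs are finite determinants of Fourier coefficients of Onsager's
explicit symbol — the objects an interval-arithmetic engine certifies. [cite: DeiftItsKrasovsky2013, §4, eq. (50)]
[cite: Panis2023Triviality, Rem. 3.22] -/
theorem tsum_twoPointFree_two_le_of_toeplitz {β₀ β : ℝ} (hβ : 0 < β) (hββ₀ : β ≤ β₀)
    (hβ₀c : β₀ < criticalBetaTwo) {L : ℕ} (hL : 1 ≤ L) {A dL : ℝ}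
    (hA : ∑ k ∈ Finset.range L,
        8 * ((k : ℝ) + 1) * (toeplitzDet (circleCoeff (onsagerSymbol β₀)) (k + 1)).re ≤ A)
    (hdL : (toeplitzDet (circleCoeff (onsagerSymbol β₀)) L).re ≤ dL)
    (hφ : 32 * L * Real.tanh β₀ * dL < 1) :
    Summable (twoPointFree 2 β) ∧
      (∑' v, twoPointFree 2 β v) ≤ (1 + A) / (1 - 32 * L * Real.tanh β₀ * dL) := by
  have hβ₀ : 0 < β₀ := hβ.trans_le hββ₀
  have hre := fun k => torusRowPairLimit_eq_re_toeplitzDet hβ₀ hβ₀c.ne k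
  refine tsum_twoPointFree_two_le_of_rowBounds_of_le hβ hββ₀ hL ?_ ?_ hφ
  · simpa only [hre] using hA
  · simpa only [hre] using hdL

/-- **Finite-volume form with Toeplitz hypotheses**: `∑_{v ∈ Λ} ⟨σ_uσ_v⟩^∅_{Λ;β,0} ≤ (1 + A)/(1 − 32L·tanh β₀·dL)`
for every finite `Λ ⊂ ℤ²`, `u ∈ Λ`, `0 < β ≤ β₀ < β_c(2)`. [cite: DeiftItsKrasovsky2013, §4, eq. (50)]
[cite: FriedliVelenik2017, proof of Thm. 3.17 (p. 114) and Exercise 3.12] -/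
theorem sum_isingTwoPoint_free_le_of_toeplitz {β₀ β : ℝ} (hβ : 0 < β) (hββ₀ : β ≤ β₀)
    (hβ₀c : β₀ < criticalBetaTwo) {L : ℕ} (hL : 1 ≤ L) {A dL : ℝ}
    (hA : ∑ k ∈ Finset.range L,
        8 * ((k : ℝ) + 1) * (toeplitzDet (circleCoeff (onsagerSymbol β₀)) (k + 1)).re ≤ A)
    (hdL : (toeplitzDet (circleCoeff (onsagerSymbol β₀)) L).re ≤ dL)
    (hφ : 32 * L * Real.tanh β₀ * dL < 1) (Λ : Finset (Site 2)) {u : Site 2} (hu : u ∈ Λ) :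
    ∑ v ∈ Λ, isingTwoPoint (zdGraph 2) Λ β 0 .free u v ≤ (1 + A) / (1 - 32 * L * Real.tanh β₀ * dL) := by
  have hβ₀ : 0 < β₀ := hβ.trans_le hββ₀
  have hre := fun k => torusRowPairLimit_eq_re_toeplitzDet hβ₀ hβ₀c.ne k
  refine sum_isingTwoPoint_free_le_of_rowBounds hβ hββ₀ hL ?_ ?_ hφ Λ hu
  · simpa only [hre] using hA
  · simpa only [hre] using hdL

end Literature.Probability.LatticeModels
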